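import Mathlib.Analysis.Complex.Exponential
import Mathlib.Analysis.SpecialFunctions.Trigonometric.Bounds
import Mathlib.Analysis.SpecialFunctions.Log.Deriv
import Mathlib.Analysis.Real.Pi.Bounds
import HarnessLib

/-!
# Kernel-evaluable fixed-point interval arithmetic over `ℝ` and `ℂ`

Trunk T-ANA (Analysis/ValidatedNumerics). A small *verified numerics engine*: intervals with
integer endpoints at the fixed binary scale `2^48` (`Literature.Analysis.ValidatedNumerics.Numerics.FI`, meaning
`[lo/2^48, hi/2^48] ⊂ ℝ`) and boxes of two such intervals (`Literature.Numerics.CB ⊂ ℂ`), with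
outward-rounded ring operations, division by positive intervals, an integer square-root upper
bound, and enclosures of `exp` (Taylor with `Real.exp_bound` / `Complex.exp_bound`), of
`θ ↦ e^{iθ}` (argument reduction by `π/2` using `Real.pi_gt_d20`, Taylor, multiplication by `i^k` and a
Lipschitz widening `Real.norm_exp_I_mul_ofReal_sub_one_le`), and of `log (1 - x)`
(`Real.abs_log_sub_add_sum_range_le`). Every operation is a total computable function on `ℤ`
(partial ones return `Option`), so that certificates built from them can be checked by the
kernel (`decide +kernel`); every operation comes with an inclusion ("soundness") theorem.

This complements the statement-layer file `IntervalEnclosure.lean` (rational endpoints,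
Mathlib's `NonemptyInterval`); the present file trades generality for evaluation speed in the
kernel (no `gcd` normalisation, no proofs inside the data). Version 2: argument reduction of
`e^{iθ}` modulo `π/2` with an exact factor `i^k` (`CB.mulIpow`), 11 Taylor terms, a shortcut for
thin intervals in `FI.expSmall` (kernel speed; the certificates downstream depend on these exact
definitions).

## Main definitions (all in `Literature.Numerics`)

* `SC = 2^48`; `FI` (fields `lo hi : ℤ`), `FI.mem x I : Prop`; `CB` (fields `re im : FI`),
  `CB.mem z B`.
* `FI.add/sub/neg/mul/mulInt/divNat/divPos/sqr/ofInt/ofFrac/widen/absHi/hull/span`,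
  `natSqrtUp`, `FI.sqrtUp`; `CB.add/sub/neg/conj/mul/mulFI/mulI/mulInt/divNat/sqr/divBox/normSqFI/widen`.
* `FI.expSmallPt`, `FI.expSmall` (`exp` on `[-1, 1]`), `CB.expISmallPt`, `CB.expI` (`e^{iθ}`),
  `FI.logOneSub` (`log (1 - x)`, `0 ≤ x ≤ ½`), `FI.pi`, `FI.sqrtI` (`√x ≤ ·`).

## Main results

* `FI.mem_add`, `mem_mul`, `mem_divPos`, …, `CB.mem_mul`, `CB.mem_divBox`, …
* `FI.mem_expSmall`, `CB.mem_expI`, `FI.mem_logOneSub`, `FI.mem_pi` — inclusion theorems for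
  the transcendental enclosures.

## References

* R. E. Moore, *Interval Analysis*, Prentice-Hall 1966, Ch. 2–4 (inclusion property,
  outward rounding, interval extensions of elementary functions). [folklore]
-/

open Real Complex Finset

namespace Literature.Analysis.ValidatedNumerics.Numerics

/-! ### The scale -/

/-- The fixed binary scale `2^48` (a literal, so that the kernel never recomputes the power).
[folklore] -/
def SC : ℕ := 281474976710656

/-- [folklore] -/
lemma SC_eq : SC = 2 ^ 48 := by norm_num [SC]

/-- [folklore] -/
lemma SC_pos : (0 : ℝ) < SC := by norm_num [SC]

/-- [folklore] -/
lemma SC_ne : (SC : ℝ) ≠ 0 := SC_pos.ne'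

/-- [folklore] -/
lemma SCZ_pos : (0 : ℤ) < SC := by norm_num [SC]

/-! ### Floor and ceiling division by a positive integer -/

/-- Ceiling division `⌈a/b⌉` for `b > 0` (the instance `/` on `ℤ` is floor division for
positive divisors). [folklore] -/
def cdiv (a b : ℤ) : ℤ := -((-a) / b)

/-- `⌊a/b⌋ · b ≤ a` read in `ℝ`. [folklore] -/
lemma fdiv_mul_le_real {a b : ℤ} (hb : 0 < b) : ((a / b : ℤ) : ℝ) * b ≤ a := by
  have h := Int.ediv_mul_le a hb.ne'
  exact_mod_cast h

/-- `a ≤ ⌈a/b⌉ · b` read in `ℝ`. [folklore] -/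
lemma le_cdiv_mul_real {a b : ℤ} (hb : 0 < b) : (a : ℝ) ≤ ((cdiv a b : ℤ) : ℝ) * b := by
  have h := Int.ediv_mul_le (-a) hb.ne'
  have h' : ((-a / b : ℤ) : ℝ) * b ≤ ((-a : ℤ) : ℝ) := by exact_mod_cast h
  rw [cdiv]
  push_cast at h' ⊢
  linarith

/-- `a/b ≥ ⌊a/b⌋` in `ℝ`, multiplicative form with a real factor. [folklore] -/
lemma fdiv_le_div {a b : ℤ} (hb : 0 < b) : ((a / b : ℤ) : ℝ) ≤ (a : ℝ) / b := by
  rw [le_div_iff₀ (by exact_mod_cast hb)]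
  exact fdiv_mul_le_real hb

/-- `a/b ≤ ⌈a/b⌉` in `ℝ`. [folklore] -/
lemma div_le_cdiv {a b : ℤ} (hb : 0 < b) : (a : ℝ) / b ≤ ((cdiv a b : ℤ) : ℝ) := by
  rw [div_le_iff₀ (by exact_mod_cast hb)]
  exact le_cdiv_mul_real hb

/-! ### Real intervals -/

/-- A real interval with integer endpoints at scale `2^48`: `⟨lo, hi⟩` stands for
`[lo/2^48, hi/2^48]`. [folklore] -/
structure FI where
  /-- scaled lower endpoint -/
  lo : ℤ
  /-- scaled upper endpoint -/
  hi : ℤ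
  deriving DecidableEq

namespace FI

/-- `x ∈ I` : `lo ≤ x · 2^48 ≤ hi`. [folklore] -/
def mem (x : ℝ) (I : FI) : Prop := (I.lo : ℝ) ≤ x * SC ∧ x * SC ≤ (I.hi : ℝ)

/-- The point interval of an integer. [folklore] -/
def ofInt (n : ℤ) : FI := ⟨n * SC, n * SC⟩

/-- The thin interval with scaled value `k`, i.e. the dyadic number `k/2^48`. [folklore] -/
def ofScaled (k : ℤ) : FI := ⟨k, k⟩

/-- An enclosure of the fraction `p/q` (`q > 0`). [folklore] -/
def ofFrac (p : ℤ) (q : ℕ) : FI := ⟨p * SC / q, cdiv (p * SC) q⟩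

/-- Sum. [folklore] -/
def add (I J : FI) : FI := ⟨I.lo + J.lo, I.hi + J.hi⟩

/-- Negation. [folklore] -/
def neg (I : FI) : FI := ⟨-I.hi, -I.lo⟩

/-- Difference. [folklore] -/
def sub (I J : FI) : FI := ⟨I.lo - J.hi, I.hi - J.lo⟩

/-- Product (Moore product, outward rounded). [folklore] -/
def mul (I J : FI) : FI :=
  let p1 := I.lo * J.lo
  let p2 := I.lo * J.hi
  let p3 := I.hi * J.lo
  let p4 := I.hi * J.hi
  ⟨min (min p1 p2) (min p3 p4) / SC, cdiv (max (max p1 p2) (max p3 p4)) SC⟩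

/-- Square. [folklore] -/
def sqr (I : FI) : FI := mul I I

/-- Product with an integer (exact). [folklore] -/
def mulInt (I : FI) (k : ℤ) : FI := if 0 ≤ k then ⟨I.lo * k, I.hi * k⟩ else ⟨I.hi * k, I.lo * k⟩

/-- Division by a positive natural number. [folklore] -/
def divNat (I : FI) (n : ℕ) : FI := ⟨I.lo / n, cdiv I.hi n⟩

/-- Division by an interval with positive lower endpoint (`none` otherwise). [folklore] -/
def divPos (I J : FI) : Option FI :=
  if 0 < J.lo then
    some ⟨if 0 ≤ I.lo then I.lo * SC / J.hi else I.lo * SC / J.lo,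
      if 0 ≤ I.hi then cdiv (I.hi * SC) J.lo else cdiv (I.hi * SC) J.hi⟩
  else none

/-- An upper bound for `|x| · 2^48` on the interval. [folklore] -/
def absHi (I : FI) : ℤ := max |I.lo| |I.hi|

/-- Symmetric widening by the non-negative scaled amount `e`. [folklore] -/
def widen (I : FI) (e : ℤ) : FI := ⟨I.lo - e, I.hi + e⟩

/-- Convex hull of two intervals. [folklore] -/
def hull (I J : FI) : FI := ⟨min I.lo J.lo, max I.hi J.hi⟩

/-- The interval `[lo(I), hi(J)]` (used for monotone functions). [folklore] -/
def span (I J : FI) : FI := ⟨I.lo, J.hi⟩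

/-! #### Inclusion theorems -/

variable {x y : ℝ} {I J : FI}

/-- [folklore] -/
lemma mem_def : mem x I ↔ (I.lo : ℝ) ≤ x * SC ∧ x * SC ≤ (I.hi : ℝ) := Iff.rfl

/-- [folklore] -/
theorem mem_ofInt (n : ℤ) : mem (n : ℝ) (ofInt n) := by
  simp [mem, ofInt]

/-- [folklore] -/
theorem mem_ofScaled (k : ℤ) : mem ((k : ℝ) / SC) (ofScaled k) := by
  simp [mem, ofScaled, div_mul_cancel₀ _ SC_ne]

/-- [folklore] -/
theorem mem_ofFrac (p : ℤ) {q : ℕ} (hq : 0 < q) : mem ((p : ℝ) / q) (ofFrac p q) := by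
  have hq' : (0 : ℤ) < q := by exact_mod_cast hq
  have hqr : (0 : ℝ) < q := by exact_mod_cast hq
  constructor
  · have h := fdiv_le_div (a := p * SC) hq'
    simp only [ofFrac, Int.cast_mul, Int.cast_natCast] at h ⊢
    rw [div_mul_eq_mul_div]; exact h
  · have h := div_le_cdiv (a := p * SC) hq'
    simp only [ofFrac, Int.cast_mul, Int.cast_natCast] at h ⊢
    rw [div_mul_eq_mul_div]; exact h

/-- [folklore] -/
theorem mem_add (hx : mem x I) (hy : mem y J) : mem (x + y) (add I J) := by
  simp only [mem, add, Int.cast_add] at hx hy ⊢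
  constructor <;> nlinarith [hx.1, hx.2, hy.1, hy.2]

/-- [folklore] -/
theorem mem_neg (hx : mem x I) : mem (-x) (neg I) := by
  simp only [mem, neg, Int.cast_neg] at hx ⊢
  constructor <;> linarith [hx.1, hx.2]

/-- [folklore] -/
theorem mem_sub (hx : mem x I) (hy : mem y J) : mem (x - y) (sub I J) := by
  simp only [mem, sub, Int.cast_sub] at hx hy ⊢
  constructor <;> linarith [hx.1, hx.2, hy.1, hy.2]

/-- The four-corner bound for products of bounded reals. [folklore] -/
lemma mul_mem_corners {a b c d u v : ℝ} (hu : a ≤ u ∧ u ≤ b) (hv : c ≤ v ∧ v ≤ d) :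
    min (min (a * c) (a * d)) (min (b * c) (b * d)) ≤ u * v ∧
      u * v ≤ max (max (a * c) (a * d)) (max (b * c) (b * d)) := by
  -- `u * v` lies between `a * v` and `b * v`, and each of these between its corner values
  have h1 : min (a * v) (b * v) ≤ u * v ∧ u * v ≤ max (a * v) (b * v) := by
    rcases le_total 0 v with hv0 | hv0
    · exact ⟨(min_le_left _ _).trans (by nlinarith), (le_max_right _ _).trans' (by nlinarith)⟩
    · exact ⟨(min_le_right _ _).trans (by nlinarith), (le_max_left _ _).trans' (by nlinarith)⟩
  have h2 : ∀ e : ℝ, min (e * c) (e * d) ≤ e * v ∧ e * v ≤ max (e * c) (e * d) := by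
    intro e
    rcases le_total 0 e with he | he
    · exact ⟨(min_le_left _ _).trans (by nlinarith), (le_max_right _ _).trans' (by nlinarith)⟩
    · exact ⟨(min_le_right _ _).trans (by nlinarith), (le_max_left _ _).trans' (by nlinarith)⟩
  have ha := h2 a
  have hb := h2 b
  constructor
  · calc min (min (a * c) (a * d)) (min (b * c) (b * d)) ≤ min (a * v) (b * v) :=
          min_le_min ha.1 hb.1
      _ ≤ u * v := h1.1
  · calc u * v ≤ max (a * v) (b * v) := h1.2
      _ ≤ max (max (a * c) (a * d)) (max (b * c) (b * d)) := max_le_max ha.2 hb.2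

/-- [folklore] -/
theorem mem_mul (hx : mem x I) (hy : mem y J) : mem (x * y) (mul I J) := by
  obtain ⟨h1, h2⟩ := mul_mem_corners hx hy
  have hxy : x * SC * (y * SC) = x * y * SC * SC := by ring
  rw [hxy] at h1 h2
  simp only [mem, mul]
  constructor
  · have h := fdiv_mul_le_real (a := min (min (I.lo * J.lo) (I.lo * J.hi))
      (min (I.hi * J.lo) (I.hi * J.hi))) SCZ_pos
    push_cast at h
    nlinarith [SC_pos]
  · have h := le_cdiv_mul_real (a := max (max (I.lo * J.lo) (I.lo * J.hi))
      (max (I.hi * J.lo) (I.hi * J.hi))) SCZ_pos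
    push_cast at h
    nlinarith [SC_pos]

/-- [folklore] -/
theorem mem_sqr (hx : mem x I) : mem (x ^ 2) (sqr I) := by
  rw [sq]; exact mem_mul hx hx

/-- [folklore] -/
theorem mem_mulInt (hx : mem x I) (k : ℤ) : mem (x * k) (mulInt I k) := by
  simp only [mem, mulInt] at hx ⊢
  split_ifs with hk
  · have hk' : (0 : ℝ) ≤ k := by exact_mod_cast hk
    simp only [Int.cast_mul]
    constructor <;> nlinarith [hx.1, hx.2]
  · have hk' : (k : ℝ) ≤ 0 := by exact_mod_cast (not_le.1 hk).le
    simp only [Int.cast_mul]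
    constructor <;> nlinarith [hx.1, hx.2]

/-- [folklore] -/
theorem mem_divNat (hx : mem x I) {n : ℕ} (hn : 0 < n) : mem (x / n) (divNat I n) := by
  have hn' : (0 : ℤ) < n := by exact_mod_cast hn
  have hnr : (0 : ℝ) < n := by exact_mod_cast hn
  simp only [mem, divNat] at hx ⊢
  constructor
  · have h := fdiv_le_div (a := I.lo) hn'
    simp only [Int.cast_natCast] at h
    rw [div_mul_eq_mul_div, le_div_iff₀ hnr]
    calc ((I.lo / n : ℤ) : ℝ) * n ≤ (I.lo : ℝ) / n * n := by gcongr
      _ = I.lo := by field_simp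
      _ ≤ x * SC := hx.1
  · have h := div_le_cdiv (a := I.hi) hn'
    simp only [Int.cast_natCast] at h
    rw [div_mul_eq_mul_div, div_le_iff₀ hnr]
    calc x * SC ≤ I.hi := hx.2
      _ = (I.hi : ℝ) / n * n := by field_simp
      _ ≤ ((cdiv I.hi n : ℤ) : ℝ) * n := by gcongr

/-- [folklore] -/
theorem mem_divPos {K : FI} (h : divPos I J = some K) (hx : mem x I) (hy : mem y J) :
    mem (x / y) K := by
  unfold divPos at h
  by_cases hJ : 0 < J.lo
  · rw [if_pos hJ, Option.some.injEq] at h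
    subst h
    have hJr : (0 : ℝ) < J.lo := by exact_mod_cast hJ
    obtain ⟨hy1, hy2⟩ := hy
    obtain ⟨hx1, hx2⟩ := hx
    have hyS : 0 < y * SC := lt_of_lt_of_le hJr hy1
    have key : x / y * SC = (x * SC) * SC / (y * SC) := by
      field_simp
    have hJhi : (0 : ℝ) < J.hi := lt_of_lt_of_le hyS hy2
    have hJhi' : (0 : ℤ) < J.hi := by exact_mod_cast hJhi
    have lo1 : 0 ≤ I.lo → ((I.lo * SC / J.hi : ℤ) : ℝ) ≤ x / y * SC := by
      intro h0
      have h0' : (0 : ℝ) ≤ I.lo := by exact_mod_cast h0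
      have h := fdiv_le_div (a := I.lo * SC) hJhi'
      push_cast at h
      rw [key]
      refine h.trans ?_
      rw [div_le_div_iff₀ hJhi hyS]
      have : (I.lo : ℝ) * SC * (y * SC) ≤ (I.lo : ℝ) * SC * J.hi := by
        apply mul_le_mul_of_nonneg_left hy2; positivity
      nlinarith [SC_pos, mul_le_mul_of_nonneg_right hx1 (le_of_lt hJhi)]
    have lo2 : ¬ 0 ≤ I.lo → ((I.lo * SC / J.lo : ℤ) : ℝ) ≤ x / y * SC := by
      intro h0
      have h0' : (I.lo : ℝ) < 0 := by exact_mod_cast (not_le.1 h0)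
      have h := fdiv_le_div (a := I.lo * SC) hJ
      push_cast at h
      rw [key]
      refine h.trans ?_
      rw [div_le_div_iff₀ hJr hyS]
      have e1 : (I.lo : ℝ) * SC * (y * SC) ≤ (I.lo : ℝ) * SC * J.lo := by
        have : (I.lo : ℝ) * SC ≤ 0 := by nlinarith [SC_pos]
        exact mul_le_mul_of_nonpos_left hy1 this
      nlinarith [SC_pos, mul_le_mul_of_nonneg_right hx1 (le_of_lt hJr)]
    have hi1 : 0 ≤ I.hi → x / y * SC ≤ ((cdiv (I.hi * SC) J.lo : ℤ) : ℝ) := by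
      intro h0
      have h0' : (0 : ℝ) ≤ I.hi := by exact_mod_cast h0
      have h := div_le_cdiv (a := I.hi * SC) hJ
      push_cast at h
      rw [key]
      refine le_trans ?_ h
      rw [div_le_div_iff₀ hyS hJr]
      have e1 : (I.hi : ℝ) * SC * J.lo ≤ (I.hi : ℝ) * SC * (y * SC) := by
        apply mul_le_mul_of_nonneg_left hy1; positivity
      nlinarith [SC_pos, mul_le_mul_of_nonneg_right hx2 (le_of_lt hJr)]
    have hi2 : ¬ 0 ≤ I.hi → x / y * SC ≤ ((cdiv (I.hi * SC) J.hi : ℤ) : ℝ) := by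
      intro h0
      have h0' : (I.hi : ℝ) < 0 := by exact_mod_cast (not_le.1 h0)
      have h := div_le_cdiv (a := I.hi * SC) hJhi'
      push_cast at h
      rw [key]
      refine le_trans ?_ h
      rw [div_le_div_iff₀ hyS hJhi]
      have e1 : (I.hi : ℝ) * SC * J.hi ≤ (I.hi : ℝ) * SC * (y * SC) := by
        have : (I.hi : ℝ) * SC ≤ 0 := by nlinarith [SC_pos]
        exact mul_le_mul_of_nonpos_left hy2 this
      nlinarith [SC_pos, mul_le_mul_of_nonneg_right hx2 (le_of_lt hJhi)]
    simp only [mem]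
    constructor
    · split_ifs with h0
      · exact lo1 h0
      · exact lo2 h0
    · split_ifs with h0
      · exact hi1 h0
      · exact hi2 h0
  · rw [if_neg hJ] at h
    simp at h

/-- [folklore] -/
theorem abs_le_absHi (hx : mem x I) : |x| * SC ≤ (absHi I : ℝ) := by
  simp only [mem] at hx
  simp only [absHi, Int.cast_max, Int.cast_abs]
  rw [← abs_of_pos SC_pos, ← abs_mul]
  rcases le_total 0 (x * SC) with h | h
  · rw [abs_of_nonneg h]
    exact le_max_of_le_right (hx.2.trans (le_abs_self _))
  · rw [abs_of_nonpos h]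
    exact le_max_of_le_left (by linarith [neg_abs_le (I.lo : ℝ)])

/-- Membership transported along an error bound: if `x ∈ I` and `|x' - x| · 2^48 ≤ e` then
`x' ∈ widen I e`. [folklore] -/
theorem mem_widen (hx : mem x I) {x' : ℝ} {e : ℤ} (he : |x' - x| * SC ≤ e) :
    mem x' (widen I e) := by
  simp only [mem, widen, Int.cast_sub, Int.cast_add] at hx ⊢
  have h1 : |x' - x| * SC = |x' * SC - x * SC| := by
    rw [← sub_mul, abs_mul, abs_of_pos SC_pos]
  rw [h1] at he
  have := abs_le.1 (le_trans (le_refl _) he)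
  constructor <;> linarith [this.1, this.2, hx.1, hx.2]

/-- [folklore] -/
theorem mem_hull_left (hx : mem x I) (J : FI) : mem x (hull I J) := by
  simp only [mem, hull, Int.cast_min, Int.cast_max] at hx ⊢
  exact ⟨(min_le_left _ _).trans hx.1, hx.2.trans (le_max_left _ _)⟩

/-- [folklore] -/
theorem mem_hull_right (hx : mem x J) (I : FI) : mem x (hull I J) := by
  simp only [mem, hull, Int.cast_min, Int.cast_max] at hx ⊢
  exact ⟨(min_le_right _ _).trans hx.1, hx.2.trans (le_max_right _ _)⟩

/-- A value between a member of `I` and a member of `J` lies in `span I J`. [folklore] -/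
theorem mem_span {u v : ℝ} (hu : mem u I) (hv : mem v J) (h1 : u ≤ x) (h2 : x ≤ v) :
    mem x (span I J) := by
  simp only [mem, span] at hu hv ⊢
  constructor <;> nlinarith [hu.1, hv.2, SC_pos]

/-- `lo ≤ hi` for an inhabited interval. [folklore] -/
theorem lo_le_hi (hx : mem x I) : I.lo ≤ I.hi := by
  have := hx.1.trans hx.2
  exact_mod_cast this

/-- Reading a sign off the endpoints. [folklore] -/
theorem pos_of_lo_pos (hx : mem x I) (h : 0 < I.lo) : 0 < x := by
  have h' : (0 : ℝ) < I.lo := by exact_mod_cast h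
  have := lt_of_lt_of_le h' hx.1
  nlinarith [SC_pos]

/-- [folklore] -/
theorem lt_of_hi_lt_lo (hx : mem x I) (hy : mem y J) (h : I.hi < J.lo) : x < y := by
  have h' : (I.hi : ℝ) < J.lo := by exact_mod_cast h
  have := lt_of_le_of_lt hx.2 (lt_of_lt_of_le h' hy.1)
  nlinarith [SC_pos]

/-- Lower endpoint as a real bound. [folklore] -/
theorem lo_div_le (hx : mem x I) : (I.lo : ℝ) / SC ≤ x := by
  rw [div_le_iff₀ SC_pos]; exact hx.1

/-- Upper endpoint as a real bound. [folklore] -/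
theorem le_hi_div (hx : mem x I) : x ≤ (I.hi : ℝ) / SC := by
  rw [le_div_iff₀ SC_pos]; exact hx.2

end FI

/-! ### Integer square root, rounded up -/

/-- Binary search for the least `r ∈ (lo, hi]` with `m ≤ r²`, given `m ≤ hi²`; returns an `r`
with `m ≤ r²` whatever the fuel. [folklore] -/
def sqrtSearch (m : ℕ) : ℕ → ℕ → ℕ → ℕ
  | 0, _, u => u
  | fuel + 1, l, u =>
      if u ≤ l + 1 then u
      else
        let mid := (l + u) / 2
        if m ≤ mid * mid then sqrtSearch m fuel l mid else sqrtSearch m fuel mid u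

/-- The search result squares to at least `m`. [folklore] -/
lemma le_sqrtSearch_sq (m : ℕ) : ∀ (fuel l u : ℕ), m ≤ u * u → m ≤ sqrtSearch m fuel l u ^ 2
  | 0, l, u, h => by simpa [sqrtSearch, sq] using h
  | fuel + 1, l, u, h => by
    simp only [sqrtSearch]
    split_ifs with h1 h2
    · simpa [sq] using h
    · exact le_sqrtSearch_sq m fuel l _ h2
    · exact le_sqrtSearch_sq m fuel _ u h

/-- An upper bound for `√m` (`m ≤ 2^130`): `m ≤ (natSqrtUp m)²`. [folklore] -/
def natSqrtUp (m : ℕ) : ℕ := sqrtSearch m 140 0 (max m 1)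

/-- [folklore] -/
lemma le_natSqrtUp_sq (m : ℕ) : m ≤ natSqrtUp m ^ 2 := by
  apply le_sqrtSearch_sq
  rcases Nat.eq_zero_or_pos m with rfl | hm
  · simp
  · calc m = m * 1 := (mul_one m).symm
      _ ≤ max m 1 * max m 1 := Nat.mul_le_mul (le_max_left _ _) (le_max_right _ _)

namespace FI

/-- An upper bound, as a scaled integer, for `√x` on an interval (`0` if `hi ≤ 0`):
`√x · 2^48 ≤ sqrtUp I`. [folklore] -/
def sqrtUp (I : FI) : ℤ := (natSqrtUp (I.hi.toNat * SC) : ℤ)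

/-- The thin interval `[0, sqrtUp I]` encloses `√x` for `x ∈ I`. [folklore] -/
def sqrtI (I : FI) : FI := ⟨0, sqrtUp I⟩

/-- [folklore] -/
theorem mem_sqrtI {x : ℝ} {I : FI} (hx : mem x I) : mem (Real.sqrt x) (sqrtI I) := by
  simp only [mem, sqrtI, sqrtUp, Int.cast_zero, Int.cast_natCast]
  refine ⟨by positivity, ?_⟩
  set m : ℕ := I.hi.toNat * SC with hm
  have h1 : (m : ℝ) ≤ (natSqrtUp m : ℝ) ^ 2 := by exact_mod_cast le_natSqrtUp_sq m
  have htoNat : (I.hi : ℝ) ≤ (I.hi.toNat : ℝ) := by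
    rw [← Int.cast_natCast]
    exact_mod_cast Int.self_le_toNat I.hi
  have h2 : x * SC * SC ≤ (m : ℝ) := by
    rw [hm]; push_cast
    have : x * SC ≤ (I.hi.toNat : ℝ) := hx.2.trans htoNat
    nlinarith [SC_pos]
  -- `√x · S ≤ r` iff `x S² ≤ r²` (both sides non-negative)
  have hr : (0 : ℝ) ≤ natSqrtUp m := by positivity
  rcases le_or_gt x 0 with hx0 | hx0
  · rw [Real.sqrt_eq_zero'.2 hx0]; simp
  · rw [← Real.sqrt_sq hr, ← Real.sqrt_sq SC_pos.le, ← Real.sqrt_mul hx0.le]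
    apply Real.sqrt_le_sqrt
    nlinarith

end FI

/-! ### Complex boxes -/

/-- A complex box: real and imaginary parts in fixed-point intervals. [folklore] -/
structure CB where
  /-- enclosure of the real part -/
  re : FI
  /-- enclosure of the imaginary part -/
  im : FI
  deriving DecidableEq

namespace CB

/-- `z ∈ B`. [folklore] -/
def mem (z : ℂ) (B : CB) : Prop := FI.mem z.re B.re ∧ FI.mem z.im B.im

/-- [folklore] -/
def ofFI (I : FI) : CB := ⟨I, FI.ofInt 0⟩
/-- [folklore] -/
def ofInt (n : ℤ) : CB := ⟨FI.ofInt n, FI.ofInt 0⟩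
/-- [folklore] -/
def add (A B : CB) : CB := ⟨A.re.add B.re, A.im.add B.im⟩
/-- [folklore] -/
def sub (A B : CB) : CB := ⟨A.re.sub B.re, A.im.sub B.im⟩
/-- [folklore] -/
def neg (A : CB) : CB := ⟨A.re.neg, A.im.neg⟩
/-- [folklore] -/
def conj (A : CB) : CB := ⟨A.re, A.im.neg⟩
/-- [folklore] -/
def mul (A B : CB) : CB :=
  ⟨(A.re.mul B.re).sub (A.im.mul B.im), (A.re.mul B.im).add (A.im.mul B.re)⟩
/-- [folklore] -/
def sqr (A : CB) : CB := mul A A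
/-- Product with a real interval. [folklore] -/
def mulFI (A : CB) (I : FI) : CB := ⟨A.re.mul I, A.im.mul I⟩
/-- Product with `i`. [folklore] -/
def mulI (A : CB) : CB := ⟨A.im.neg, A.re⟩
/-- Product with an integer. [folklore] -/
def mulInt (A : CB) (k : ℤ) : CB := ⟨A.re.mulInt k, A.im.mulInt k⟩
/-- Division by a positive natural. [folklore] -/
def divNat (A : CB) (n : ℕ) : CB := ⟨A.re.divNat n, A.im.divNat n⟩
/-- Enclosure of `|z|²`. [folklore] -/
def normSqFI (A : CB) : FI := A.re.sqr.add A.im.sqr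
/-- Division `A / B` through `A · conj B / |B|²` (`none` unless `|B|²` is bounded below by a
positive number). [folklore] -/
def divBox (A B : CB) : Option CB :=
  let n := normSqFI B
  let num := mul A (conj B)
  match num.re.divPos n, num.im.divPos n with
  | some r, some i => some ⟨r, i⟩
  | _, _ => none
/-- Widening of both parts. [folklore] -/
def widen (A : CB) (e : ℤ) : CB := ⟨A.re.widen e, A.im.widen e⟩
/-- Product with `i^r`, `r ∈ {0, 1, 2, 3}` (exact). [folklore] -/
def mulIpow (A : CB) (r : ℤ) : CB :=
  if r = 0 then A else if r = 1 then A.mulI else if r = 2 then A.neg else (A.mulI).neg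

variable {z w : ℂ} {A B : CB}

/-- [folklore] -/
theorem mem_ofFI {x : ℝ} {I : FI} (hx : FI.mem x I) : mem (x : ℂ) (ofFI I) := by
  refine ⟨?_, ?_⟩ <;> dsimp only [ofFI]
  · simpa using hx
  · simpa using FI.mem_ofInt 0

/-- [folklore] -/
theorem mem_ofInt (n : ℤ) : mem (n : ℂ) (ofInt n) := by
  refine ⟨?_, ?_⟩ <;> dsimp only [ofInt]
  · simpa using FI.mem_ofInt n
  · simpa using FI.mem_ofInt 0

/-- [folklore] -/
theorem mem_add (hz : mem z A) (hw : mem w B) : mem (z + w) (add A B) := by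
  refine ⟨?_, ?_⟩ <;> dsimp only [add]
  · simpa using FI.mem_add hz.1 hw.1
  · simpa using FI.mem_add hz.2 hw.2

/-- [folklore] -/
theorem mem_sub (hz : mem z A) (hw : mem w B) : mem (z - w) (sub A B) := by
  refine ⟨?_, ?_⟩ <;> dsimp only [sub]
  · simpa using FI.mem_sub hz.1 hw.1
  · simpa using FI.mem_sub hz.2 hw.2

/-- [folklore] -/
theorem mem_neg (hz : mem z A) : mem (-z) (neg A) := by
  refine ⟨?_, ?_⟩ <;> dsimp only [neg]
  · simpa using FI.mem_neg hz.1
  · simpa using FI.mem_neg hz.2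

/-- [folklore] -/
theorem mem_conj (hz : mem z A) : mem (starRingEnd ℂ z) (conj A) := by
  refine ⟨?_, ?_⟩ <;> dsimp only [conj]
  · simpa using hz.1
  · simpa using FI.mem_neg hz.2

/-- [folklore] -/
theorem mem_mul (hz : mem z A) (hw : mem w B) : mem (z * w) (mul A B) := by
  refine ⟨?_, ?_⟩ <;> dsimp only [mul]
  · simpa [Complex.mul_re] using FI.mem_sub (FI.mem_mul hz.1 hw.1) (FI.mem_mul hz.2 hw.2)
  · simpa [Complex.mul_im] using FI.mem_add (FI.mem_mul hz.1 hw.2) (FI.mem_mul hz.2 hw.1)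

/-- [folklore] -/
theorem mem_sqr (hz : mem z A) : mem (z ^ 2) (sqr A) := by
  rw [sq]; exact mem_mul hz hz

/-- [folklore] -/
theorem mem_mulFI {x : ℝ} {I : FI} (hz : mem z A) (hx : FI.mem x I) :
    mem (z * x) (mulFI A I) := by
  refine ⟨?_, ?_⟩ <;> dsimp only [mulFI]
  · simpa using FI.mem_mul hz.1 hx
  · simpa using FI.mem_mul hz.2 hx

/-- [folklore] -/
theorem mem_mulI (hz : mem z A) : mem (z * Complex.I) (mulI A) := by
  refine ⟨?_, ?_⟩ <;> dsimp only [mulI]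
  · simpa using FI.mem_neg hz.2
  · simpa using hz.1

/-- [folklore] -/
theorem mem_mulIpow (hz : mem z A) {r : ℤ} (hr : 0 ≤ r) (hr4 : r < 4) :
    mem (z * Complex.I ^ r.toNat) (mulIpow A r) := by
  unfold mulIpow
  have hr' : r = 0 ∨ r = 1 ∨ r = 2 ∨ r = 3 := by omega
  rcases hr' with rfl | rfl | rfl | rfl
  · simpa using hz
  · simpa using mem_mulI hz
  · simp only [show ¬((2 : ℤ) = 0) by norm_num, show ¬((2 : ℤ) = 1) by norm_num, if_false, if_true]
    have : z * Complex.I ^ (2 : ℤ).toNat = -z := by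
      rw [show (2 : ℤ).toNat = 2 by rfl, Complex.I_sq]; ring
    rw [this]; exact mem_neg hz
  · simp only [show ¬((3 : ℤ) = 0) by norm_num, show ¬((3 : ℤ) = 1) by norm_num,
      show ¬((3 : ℤ) = 2) by norm_num, if_false]
    have : z * Complex.I ^ (3 : ℤ).toNat = -(z * Complex.I) := by
      rw [show (3 : ℤ).toNat = 3 by rfl, pow_three, ← mul_assoc, ← mul_assoc, mul_assoc z,
        Complex.I_mul_I]; ring
    rw [this]; exact mem_neg (mem_mulI hz)

/-- [folklore] -/
theorem mem_mulInt (hz : mem z A) (k : ℤ) : mem (z * k) (mulInt A k) := by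
  refine ⟨?_, ?_⟩ <;> dsimp only [mulInt]
  · simpa using FI.mem_mulInt hz.1 k
  · simpa using FI.mem_mulInt hz.2 k

/-- [folklore] -/
theorem mem_divNat (hz : mem z A) {n : ℕ} (hn : 0 < n) : mem (z / n) (divNat A n) := by
  refine ⟨?_, ?_⟩ <;> dsimp only [divNat]
  · simpa [Complex.div_natCast_re] using FI.mem_divNat hz.1 hn
  · simpa [Complex.div_natCast_im] using FI.mem_divNat hz.2 hn

/-- [folklore] -/
theorem mem_normSqFI (hz : mem z A) : FI.mem (Complex.normSq z) (normSqFI A) := by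
  rw [Complex.normSq_apply]
  have := FI.mem_add (FI.mem_sqr hz.1) (FI.mem_sqr hz.2)
  dsimp only [normSqFI]
  simpa [sq] using this

/-- [folklore] -/
theorem mem_divBox {C : CB} (h : divBox A B = some C) (hz : mem z A) (hw : mem w B) :
    mem (z / w) C := by
  unfold divBox at h
  simp only at h
  split at h
  · rename_i r i hr hi
    simp only [Option.some.injEq] at h
    subst h
    have hn := mem_normSqFI hw
    have hnum := mem_mul hz (mem_conj hw)
    have hpos : 0 < (normSqFI B).lo := by
      by_contra hle
      unfold FI.divPos at hr
      rw [if_neg hle] at hr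
      simp at hr
    have hw0 : w ≠ 0 := by
      intro h0
      have := FI.pos_of_lo_pos hn hpos
      simp [h0] at this
    have key : z / w = z * starRingEnd ℂ w / (Complex.normSq w : ℂ) := by
      rw [div_eq_mul_inv, Complex.inv_def, Complex.ofReal_inv]; ring
    rw [key]
    refine ⟨?_, ?_⟩
    · have := FI.mem_divPos hr hnum.1 hn
      simpa [Complex.div_ofReal_re] using this
    · have := FI.mem_divPos hi hnum.2 hn
      simpa [Complex.div_ofReal_im] using this
  · simp at h

/-- Widening along a norm bound: `z ∈ A`, `‖z' - z‖ · 2^48 ≤ e` ⇒ `z' ∈ widen A e`. [folklore] -/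
theorem mem_widen (hz : mem z A) {z' : ℂ} {e : ℤ} (he : ‖z' - z‖ * SC ≤ e) :
    mem z' (widen A e) := by
  refine ⟨?_, ?_⟩ <;> dsimp only [widen]
  refine FI.mem_widen hz.1 (le_trans ?_ he)
  rotate_left
  refine FI.mem_widen hz.2 (le_trans ?_ he)
  rotate_left
  · have := Complex.abs_re_le_norm (z' - z)
    simp only [Complex.sub_re] at this
    exact mul_le_mul_of_nonneg_right this SC_pos.le
  · have := Complex.abs_im_le_norm (z' - z)
    simp only [Complex.sub_im] at this
    exact mul_le_mul_of_nonneg_right this SC_pos.le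

/-- `‖z‖ · 2^48 ≤ absHi re + absHi im`. [folklore] -/
theorem norm_le_absHi (hz : mem z A) :
    ‖z‖ * SC ≤ (A.re.absHi : ℝ) + A.im.absHi := by
  have h1 := FI.abs_le_absHi hz.1
  have h2 := FI.abs_le_absHi hz.2
  have h3 : ‖z‖ ≤ |z.re| + |z.im| := Complex.norm_le_abs_re_add_abs_im z
  nlinarith [SC_pos]

end CB

/-! ### The exponential on `[-1, 1]` -/

namespace FI

/-- One run of the Taylor recurrence: from `(term, sum)` enclosing `(x^m/m!, Σ_{j<m} x^j/j!)`
produce the pair for `m + n`. [folklore] -/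
def expStep (X : FI) : ℕ → ℕ → FI → FI → FI × FI
  | 0, _, term, sum => (term, sum)
  | n + 1, m, term, sum => expStep X n (m + 1) ((term.mul X).divNat (m + 1)) (sum.add term)

/-- The number of Taylor terms used for `exp`. [folklore] -/
def expTerms : ℕ := 11

/-- Enclosure of `exp x` for a THIN interval `X ∋ x` with `|x| ≤ 1` (checked: `none`
otherwise): Taylor polynomial of degree `< 11` plus the remainder bound `Real.exp_bound`.
[folklore] -/
def expSmallPt (X : FI) : Option FI :=
  if -(SC : ℤ) ≤ X.lo ∧ X.hi ≤ SC then
    let p := expStep X expTerms 0 ⟨SC, SC⟩ ⟨0, 0⟩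
    let e := cdiv (p.1.absHi * (expTerms + 1)) expTerms
    some (p.2.widen e)
  else none

/-- Enclosure of `exp` on an interval `X ⊆ [-1,1]`, by monotonicity from the endpoints.
[folklore] -/
def expSmall (X : FI) : Option FI :=
  if X.lo = X.hi then expSmallPt (ofScaled X.lo)
  else
    match expSmallPt (ofScaled X.lo), expSmallPt (ofScaled X.hi) with
    | some A, some B => some (span A B)
    | _, _ => none

variable {x : ℝ} {X : FI}

/-- Invariant of the Taylor recurrence for `exp`. [folklore] -/
lemma expStep_spec (hx : mem x X) :
    ∀ (n m : ℕ) (term sum : FI), mem (x ^ m / m.factorial) term →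
      mem (∑ j ∈ range m, x ^ j / j.factorial) sum →
      mem (x ^ (m + n) / (m + n).factorial) (expStep X n m term sum).1 ∧
        mem (∑ j ∈ range (m + n), x ^ j / j.factorial) (expStep X n m term sum).2
  | 0, m, term, sum, ht, hs => by simpa [expStep] using And.intro ht hs
  | n + 1, m, term, sum, ht, hs => by
    have ht' : mem (x ^ (m + 1) / (m + 1).factorial) ((term.mul X).divNat (m + 1)) := by
      have h := mem_divNat (mem_mul ht hx) (Nat.succ_pos m)
      convert h using 1
      rw [Nat.factorial_succ, pow_succ]
      push_cast
      field_simp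
    have hs' : mem (∑ j ∈ range (m + 1), x ^ j / j.factorial) (sum.add term) := by
      rw [Finset.sum_range_succ]
      exact mem_add hs ht
    have := expStep_spec hx n (m + 1) _ _ ht' hs'
    simp only [expStep]
    rwa [show m + (n + 1) = m + 1 + n by ring]

/-- [folklore] -/
theorem mem_expSmallPt {Y : FI} (h : expSmallPt X = some Y) (hx : mem x X) :
    mem (Real.exp x) Y := by
  unfold expSmallPt at h
  split_ifs at h with hb
  simp only [Option.some.injEq] at h
  subst h
  have habs : |x| ≤ 1 := by
    have h1 : (-(SC : ℤ) : ℝ) ≤ x * SC := le_trans (by exact_mod_cast hb.1) hx.1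
    have h2 : x * SC ≤ SC := le_trans hx.2 (by exact_mod_cast hb.2)
    rw [abs_le]
    push_cast at h1
    constructor <;> nlinarith [SC_pos]
  have h0 : mem (x ^ 0 / (0 : ℕ).factorial) (⟨SC, SC⟩ : FI) := by
    simpa [ofInt] using mem_ofInt 1
  have hs0 : mem (∑ j ∈ range 0, x ^ j / j.factorial) (⟨0, 0⟩ : FI) := by
    simpa [ofInt] using mem_ofInt 0
  obtain ⟨hterm, hsum⟩ := expStep_spec hx expTerms 0 _ _ h0 hs0
  simp only [zero_add] at hterm hsum
  set p := expStep X expTerms 0 ⟨SC, SC⟩ ⟨0, 0⟩ with hp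
  clear_value p
  apply mem_widen hsum
  -- the remainder
  have hb := Real.exp_bound habs (n := expTerms) (by norm_num [expTerms])
  have hT := abs_le_absHi hterm
  rw [abs_div, abs_pow, Nat.abs_cast] at hT
  have hrem : |Real.exp x - ∑ j ∈ range expTerms, x ^ j / j.factorial| * SC ≤
      ((p.1.absHi : ℝ) * (expTerms + 1)) / expTerms := by
    have hfac : (0 : ℝ) < (expTerms.factorial : ℝ) := by positivity
    have hT' : |x| ^ expTerms * SC ≤ (p.1.absHi : ℝ) * expTerms.factorial := by
      rw [div_mul_eq_mul_div, div_le_iff₀ hfac] at hT; exact hT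
    calc |Real.exp x - ∑ j ∈ range expTerms, x ^ j / j.factorial| * SC
        ≤ |x| ^ expTerms * ((expTerms.succ : ℝ) * ((expTerms.factorial : ℝ) * expTerms)⁻¹) * SC :=
          mul_le_mul_of_nonneg_right hb SC_pos.le
      _ = (|x| ^ expTerms * SC) * (expTerms + 1) / (expTerms.factorial * expTerms) := by
          push_cast; ring
      _ ≤ ((p.1.absHi : ℝ) * expTerms.factorial) * (expTerms + 1) /
            (expTerms.factorial * expTerms) := by gcongr
      _ = _ := by field_simp
  refine hrem.trans ?_
  have := div_le_cdiv (a := p.1.absHi * (expTerms + 1)) (b := expTerms) (by norm_num [expTerms])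
  push_cast at this
  exact this

/-- [folklore] -/
theorem mem_expSmall {Y : FI} (h : expSmall X = some Y) (hx : mem x X) : mem (Real.exp x) Y := by
  unfold expSmall at h
  by_cases hth : X.lo = X.hi
  · -- thin interval: `x = lo / 2^48`
    rw [if_pos hth] at h
    have hxeq : x = (X.lo : ℝ) / SC := by
      have h1 := hx.1
      have h2 := hx.2
      rw [← hth] at h2
      rw [eq_div_iff SC_ne]
      exact le_antisymm h2 h1
    rw [hxeq]
    exact mem_expSmallPt h (mem_ofScaled X.lo)
  · rw [if_neg hth] at h
    split at h
    · rename_i A B hA hB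
      simp only [Option.some.injEq] at h
      subst h
      have h1 := mem_expSmallPt hA (mem_ofScaled X.lo)
      have h2 := mem_expSmallPt hB (mem_ofScaled X.hi)
      exact mem_span h1 h2 (Real.exp_le_exp.2 (lo_div_le hx)) (Real.exp_le_exp.2 (le_hi_div hx))
    · simp at h

/-! ### `π` -/

/-- `π ∈ [884279719003555, 884279719003556] / 2^48`. [folklore] -/
def pi : FI := ⟨884279719003555, 884279719003556⟩

/-- [folklore] -/
theorem mem_pi : mem Real.pi pi := by
  have h1 := Real.pi_gt_d20
  have h2 := Real.pi_lt_d20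
  simp only [mem, pi, SC]
  push_cast
  constructor <;> nlinarith

/-! ### `log (1 - x)` for `0 ≤ x ≤ 1/2` -/

/-- The recurrence for `Σ_{i<n} x^{i+1}/(i+1)`: `(pow, sum) = (x^{i+1}, Σ_{j<i} x^{j+1}/(j+1))`.
[folklore] -/
def logStep (X : FI) : ℕ → ℕ → FI → FI → FI × FI
  | 0, _, pow, sum => (pow, sum)
  | n + 1, i, pow, sum => logStep X n (i + 1) (pow.mul X) (sum.add (pow.divNat (i + 1)))

/-- Enclosure of `log (1 - x)` for an interval `X ⊆ [0, 1/2]` (`none` otherwise), from `K`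
terms of the series and the tail bound `Real.abs_log_sub_add_sum_range_le` (`≤ 2 x^{K+1}`).
[folklore] -/
def logOneSub (X : FI) (K : ℕ) : Option FI :=
  if 0 ≤ X.lo ∧ 2 * X.hi ≤ SC then
    let p := logStep X K 0 X ⟨0, 0⟩
    some (p.2.neg.widen (2 * p.1.absHi))
  else none

/-- Invariant of the series recurrence for `log (1 - x)`. [folklore] -/
lemma logStep_spec (hx : mem x X) :
    ∀ (n i : ℕ) (pow sum : FI), mem (x ^ (i + 1)) pow →
      mem (∑ j ∈ range i, x ^ (j + 1) / (j + 1)) sum →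
      mem (x ^ (i + n + 1)) (logStep X n i pow sum).1 ∧
        mem (∑ j ∈ range (i + n), x ^ (j + 1) / (j + 1)) (logStep X n i pow sum).2
  | 0, i, pow, sum, hp, hs => by simpa [logStep] using And.intro hp hs
  | n + 1, i, pow, sum, hp, hs => by
    have hp' : mem (x ^ (i + 1 + 1)) (pow.mul X) := by
      rw [pow_succ]; exact mem_mul hp hx
    have hs' : mem (∑ j ∈ range (i + 1), x ^ (j + 1) / (j + 1)) (sum.add (pow.divNat (i + 1))) := by
      rw [Finset.sum_range_succ]
      refine mem_add hs ?_
      have := mem_divNat hp (Nat.succ_pos i)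
      push_cast at this ⊢
      exact this
    have := logStep_spec hx n (i + 1) _ _ hp' hs'
    simp only [logStep]
    rw [show i + (n + 1) = i + 1 + n by ring]
    exact this

/-- [folklore] -/
theorem mem_logOneSub {K : ℕ} {Y : FI} (h : logOneSub X K = some Y) (hx : mem x X) :
    mem (Real.log (1 - x)) Y := by
  unfold logOneSub at h
  split_ifs at h with hb
  simp only [Option.some.injEq] at h
  subst h
  have hx0 : 0 ≤ x := by
    have := le_trans (show ((0 : ℤ) : ℝ) ≤ X.lo by exact_mod_cast hb.1) hx.1
    simp at this; nlinarith [SC_pos]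
  have hx2 : x ≤ 1 / 2 := by
    have h2 : (2 * X.hi : ℝ) ≤ SC := by exact_mod_cast hb.2
    nlinarith [hx.2, SC_pos]
  have habs : |x| < 1 := by rw [abs_of_nonneg hx0]; linarith
  obtain ⟨hpow, hsum⟩ := logStep_spec hx K 0 X ⟨0, 0⟩ (by simpa using hx)
    (by simpa [ofInt] using mem_ofInt 0)
  simp only [zero_add] at hpow hsum
  set p := logStep X K 0 X ⟨0, 0⟩ with hp
  clear_value p
  apply mem_widen (mem_neg hsum)
  have htail := Real.abs_log_sub_add_sum_range_le habs K
  have hP := abs_le_absHi hpow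
  rw [abs_of_nonneg (pow_nonneg hx0 _)] at hP
  have h1 : |x| ^ (K + 1) / (1 - |x|) ≤ 2 * x ^ (K + 1) := by
    rw [abs_of_nonneg hx0, div_le_iff₀ (by linarith)]
    nlinarith [pow_nonneg hx0 (K + 1)]
  have h2 : |Real.log (1 - x) - -∑ j ∈ range K, x ^ (j + 1) / (j + 1)| =
      |∑ i ∈ range K, x ^ (i + 1) / (i + 1) + Real.log (1 - x)| := by
    rw [sub_neg_eq_add, add_comm]
  rw [h2]
  push_cast
  nlinarith [htail, h1, hP, SC_pos]

end FI

/-! ### `e^{iθ}` -/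

namespace CB

/-- Taylor recurrence for `exp (i φ)`, `φ` a thin real interval: `(term, sum)`. [folklore] -/
def expIStep (Φ : FI) : ℕ → ℕ → CB → CB → CB × CB
  | 0, _, term, sum => (term, sum)
  | n + 1, m, term, sum =>
      expIStep Φ n (m + 1) (((term.mulFI Φ).mulI).divNat (m + 1)) (sum.add term)

/-- Enclosure of `e^{iφ}` for a thin `Φ ∋ φ`, `|φ| ≤ 1` (`none` otherwise). [folklore] -/
def expISmallPt (Φ : FI) : Option CB :=
  if -(SC : ℤ) ≤ Φ.lo ∧ Φ.hi ≤ SC then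
    let p := expIStep Φ FI.expTerms 0 (ofInt 1) (ofInt 0)
    let e := cdiv ((p.1.re.absHi + p.1.im.absHi) * (FI.expTerms + 1)) FI.expTerms
    some (p.2.widen e)
  else none

/-- Enclosure of `{e^{iθ} : θ ∈ Θ}` for any interval `Θ` (of moderate size): reduce
`θ₀ = lo Θ` modulo `π/2` (`θ₀ = ψ + kπ/2`, `|ψ| ≤ π/4 < 1`), evaluate `e^{iψ}` by Taylor, multiply
by `i^k` exactly, and widen by the width of `Θ` (`|e^{iθ} - e^{iθ₀}| ≤ |θ - θ₀|`). [folklore] -/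
def expI (Θ : FI) : Option CB :=
  let halfPi := FI.pi.divNat 2
  let k : ℤ := (2 * Θ.lo + halfPi.lo) / (2 * halfPi.lo)    -- nearest integer to θ₀/(π/2), roughly
  let ψ : FI := (FI.ofScaled Θ.lo).sub (halfPi.mulInt k)   -- encloses θ₀ - kπ/2
  match expISmallPt (FI.ofScaled ψ.lo) with
  | some A => some (((A.widen (ψ.hi - ψ.lo)).mulIpow (k % 4)).widen (Θ.hi - Θ.lo))
  | none => none

variable {φ θ : ℝ} {Φ Θ : FI}

/-- Invariant of the Taylor recurrence for `exp (iφ)`. [folklore] -/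
lemma expIStep_spec (hφ : FI.mem φ Φ) :
    ∀ (n m : ℕ) (term sum : CB), mem ((φ * Complex.I) ^ m / m.factorial) term →
      mem (∑ j ∈ range m, (φ * Complex.I) ^ j / j.factorial) sum →
      mem ((φ * Complex.I) ^ (m + n) / (m + n).factorial) (expIStep Φ n m term sum).1 ∧
        mem (∑ j ∈ range (m + n), (φ * Complex.I) ^ j / j.factorial) (expIStep Φ n m term sum).2
  | 0, m, term, sum, ht, hs => by simpa [expIStep] using And.intro ht hs
  | n + 1, m, term, sum, ht, hs => by
    have ht' : mem ((φ * Complex.I) ^ (m + 1) / (m + 1).factorial)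
        (((term.mulFI Φ).mulI).divNat (m + 1)) := by
      have h := mem_divNat (mem_mulI (mem_mulFI ht hφ)) (Nat.succ_pos m)
      convert h using 1
      rw [Nat.factorial_succ, pow_succ]
      push_cast
      field_simp
    have hs' : mem (∑ j ∈ range (m + 1), (φ * Complex.I) ^ j / j.factorial) (sum.add term) := by
      rw [Finset.sum_range_succ]
      exact mem_add hs ht
    have := expIStep_spec hφ n (m + 1) _ _ ht' hs'
    simp only [expIStep]
    rwa [show m + (n + 1) = m + 1 + n by ring]

/-- [folklore] -/
theorem mem_expISmallPt {Y : CB} (h : expISmallPt Φ = some Y) (hφ : FI.mem φ Φ) :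
    mem (Complex.exp (φ * Complex.I)) Y := by
  unfold expISmallPt at h
  split_ifs at h with hb
  simp only [Option.some.injEq] at h
  subst h
  have habs : |φ| ≤ 1 := by
    have h1 : (-(SC : ℤ) : ℝ) ≤ φ * SC := le_trans (by exact_mod_cast hb.1) hφ.1
    have h2 : φ * SC ≤ SC := le_trans hφ.2 (by exact_mod_cast hb.2)
    rw [abs_le]
    push_cast at h1
    constructor <;> nlinarith [SC_pos]
  have hnorm : ‖(φ : ℂ) * Complex.I‖ ≤ 1 := by simpa using habs
  have h0 : mem ((φ * Complex.I) ^ 0 / (0 : ℕ).factorial) (ofInt 1) := by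
    simpa using mem_ofInt 1
  have hs0 : mem (∑ j ∈ range 0, (φ * Complex.I) ^ j / j.factorial) (ofInt 0) := by
    simpa using mem_ofInt 0
  obtain ⟨hterm, hsum⟩ := expIStep_spec hφ FI.expTerms 0 _ _ h0 hs0
  simp only [zero_add] at hterm hsum
  set p := expIStep Φ FI.expTerms 0 (ofInt 1) (ofInt 0) with hp
  clear_value p
  apply mem_widen hsum
  have hb' := Complex.exp_bound hnorm (n := FI.expTerms) (by norm_num [FI.expTerms])
  have hT := norm_le_absHi hterm
  rw [norm_div, norm_pow, Complex.norm_natCast] at hT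
  have hfac : (0 : ℝ) < (FI.expTerms.factorial : ℝ) := by positivity
  have hT' : ‖(φ : ℂ) * Complex.I‖ ^ FI.expTerms * SC ≤
      ((p.1.re.absHi : ℝ) + p.1.im.absHi) * FI.expTerms.factorial := by
    rw [div_mul_eq_mul_div, div_le_iff₀ hfac] at hT; exact hT
  have hrem : ‖Complex.exp (φ * Complex.I) -
      ∑ j ∈ range FI.expTerms, (φ * Complex.I) ^ j / j.factorial‖ * SC ≤
      (((p.1.re.absHi : ℝ) + p.1.im.absHi) * (FI.expTerms + 1)) / FI.expTerms := by
    calc _ ≤ ‖(φ : ℂ) * Complex.I‖ ^ FI.expTerms *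
          ((FI.expTerms.succ : ℝ) * ((FI.expTerms.factorial : ℝ) * FI.expTerms)⁻¹) * SC :=
          mul_le_mul_of_nonneg_right hb' SC_pos.le
      _ = (‖(φ : ℂ) * Complex.I‖ ^ FI.expTerms * SC) * (FI.expTerms + 1) /
            (FI.expTerms.factorial * FI.expTerms) := by push_cast; ring
      _ ≤ (((p.1.re.absHi : ℝ) + p.1.im.absHi) * FI.expTerms.factorial) * (FI.expTerms + 1) /
            (FI.expTerms.factorial * FI.expTerms) := by gcongr
      _ = _ := by field_simp
  refine hrem.trans ?_
  have := div_le_cdiv (a := (p.1.re.absHi + p.1.im.absHi) * (FI.expTerms + 1))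
    (b := FI.expTerms) (by norm_num [FI.expTerms])
  push_cast at this
  exact this

/-- `|e^{ia} - e^{ib}| ≤ |a - b|`. [folklore] -/
lemma norm_exp_I_sub_exp_I_le (a b : ℝ) :
    ‖Complex.exp (a * Complex.I) - Complex.exp (b * Complex.I)‖ ≤ |a - b| := by
  have h : Complex.exp (a * Complex.I) - Complex.exp (b * Complex.I) =
      Complex.exp (b * Complex.I) * (Complex.exp (Complex.I * (a - b : ℝ)) - 1) := by
    rw [mul_sub, mul_one, ← Complex.exp_add]
    push_cast
    ring_nf
  rw [h, norm_mul, Complex.norm_exp_ofReal_mul_I, one_mul]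
  have := Real.norm_exp_I_mul_ofReal_sub_one_le (x := a - b)
  simpa [Real.norm_eq_abs] using this

/-- `e^{i k π/2} = i^{k mod 4}`. [folklore] -/
lemma exp_int_mul_pi_div_two (k : ℤ) :
    Complex.exp ((k : ℂ) * (Real.pi / 2 * Complex.I)) = Complex.I ^ (k % 4).toNat := by
  rw [Complex.exp_int_mul, Complex.exp_pi_div_two_mul_I]
  have hr : 0 ≤ k % 4 := Int.emod_nonneg k (by norm_num)
  conv_lhs => rw [← Int.mul_ediv_add_emod k 4]
  rw [zpow_add₀ Complex.I_ne_zero, zpow_mul, show (Complex.I ^ (4 : ℤ)) = 1 by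
      rw [show (4 : ℤ) = ((4 : ℕ) : ℤ) by rfl, zpow_natCast, Complex.I_pow_four], one_zpow, one_mul]
  conv_lhs => rw [show (k % 4 : ℤ) = (((k % 4).toNat : ℕ) : ℤ) by rw [Int.toNat_of_nonneg hr]]
  rw [zpow_natCast]

/-- [folklore] -/
theorem mem_expI {Y : CB} (h : expI Θ = some Y) (hθ : FI.mem θ Θ) :
    mem (Complex.exp (θ * Complex.I)) Y := by
  unfold expI at h
  simp only at h
  split at h
  · rename_i A hA
    simp only [Option.some.injEq] at h
    subst h
    -- notation
    set halfPi := FI.pi.divNat 2 with hhalfPi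
    set k : ℤ := (2 * Θ.lo + halfPi.lo) / (2 * halfPi.lo) with hk
    set ψI : FI := (FI.ofScaled Θ.lo).sub (halfPi.mulInt k) with hψI
    -- the reduced angle
    set θ₀ : ℝ := (Θ.lo : ℝ) / SC with hθ₀
    set ψ : ℝ := θ₀ - Real.pi / 2 * k with hψ
    have hψmem : FI.mem ψ ψI := by
      have h1 := FI.mem_ofScaled Θ.lo
      have h2 : FI.mem (Real.pi / 2 * k) (halfPi.mulInt k) := by
        have := FI.mem_mulInt (FI.mem_divNat FI.mem_pi (n := 2) (by norm_num)) k
        rw [hhalfPi]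
        convert this using 1
        push_cast; ring
      exact FI.mem_sub h1 h2
    -- `e^{iψ}` from the thin evaluation at `lo ψI` and the width of `ψI`
    have hA' := mem_expISmallPt hA (FI.mem_ofScaled ψI.lo)
    have hkey : mem (Complex.exp ((ψ : ℝ) * Complex.I)) (A.widen (ψI.hi - ψI.lo)) := by
      apply mem_widen hA'
      refine le_trans (mul_le_mul_of_nonneg_right (norm_exp_I_sub_exp_I_le _ _) SC_pos.le) ?_
      have h1 := hψmem.1
      have h2 := hψmem.2
      rw [abs_of_nonneg (by rw [sub_nonneg, div_le_iff₀ SC_pos]; exact h1)]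
      rw [sub_mul, div_mul_cancel₀ _ SC_ne]
      push_cast
      linarith
    -- multiply by `i^k`
    have hr0 : 0 ≤ k % 4 := Int.emod_nonneg k (by norm_num)
    have hr4 : k % 4 < 4 := Int.emod_lt_of_pos k (by norm_num)
    have hrot := mem_mulIpow hkey hr0 hr4
    have hper : Complex.exp ((ψ : ℝ) * Complex.I) * Complex.I ^ (k % 4).toNat =
        Complex.exp ((θ₀ : ℝ) * Complex.I) := by
      rw [← exp_int_mul_pi_div_two, ← Complex.exp_add, hψ]
      congr 1
      push_cast
      ring
    rw [hper] at hrot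
    -- widen by the width of `Θ`
    apply mem_widen hrot
    refine le_trans (mul_le_mul_of_nonneg_right (norm_exp_I_sub_exp_I_le _ _) SC_pos.le) ?_
    rw [abs_of_nonneg (by rw [sub_nonneg, hθ₀, div_le_iff₀ SC_pos]; exact hθ.1)]
    rw [sub_mul, hθ₀, div_mul_cancel₀ _ SC_ne]
    push_cast
    linarith [hθ.2]
  · simp at h

end CB

end Literature.Analysis.ValidatedNumerics.Numerics
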